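import Mathlib
import Mathlib.MeasureTheory.Function.LpSeminorm.Basic
import Mathlib.MeasureTheory.Function.LocallyIntegrable
import Literature.Analysis.FluidPDE.SelfSimilar
import Literature.Analysis.FluidPDE.MildSolution
import Literature.Analysis.FluidPDE.SuitableWeak
import Literature.Analysis.FluidPDE.AxisymmetricEuler
import Literature.Analysis.FluidPDE.NSWave0
import HarnessLib.Audit
import Literature.Analysis.FluidPDE.SelfSimilarLiouville
import HarnessLib

/-!
# TypeIDSSLiouvilleConjecture — CONJECTURE (obligation of NavierStokesRegularity/NavierStokesRegularity)

Unproven conjecture migrated by the gate from `Literature/Analysis/FluidPDE/SelfSimilarLiouville.lean` (`Literature.Analysis.FluidPDE.TypeIDSSLiouvilleConjecture`): unproven conjectures are obligations of our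
theories, not literature facts (human ruling 2026-08-15). Provenance: see docstring. Routes use it as a crux item or via
`--conditional-bridge --conditional-on TypeIDSSLiouvilleConjecture`; a proof goes in the sibling `Theorems/TypeIDSSLiouvilleConjectureHolds.lean` as `theorem TypeIDSSLiouvilleConjecture_holds : TypeIDSSLiouvilleConjecture` so this file stays a conjecture LEAF that Literature/ may import.
-/

namespace Summit.NavierStokesRegularity.NavierStokesRegularity

open Literature Literature.Analysis Literature.Analysis.FluidPDE
open MeasureTheory Set Function Filter Topology TopologicalSpace
open scoped ContDiff NNReal ENNReal InnerProductSpace RealInnerProductSpace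
local notation "ℝ³" => EuclideanSpace ℝ (Fin 3)

/-- **ns.S26** (the Type I DSS Liouville wall as a single statement,
`summits/ns-w-typeI-dss-liouville`; Tsai GSM 192, Conjectures 8.8–8.9; inventory: "for every
`λ > 1`, `α`, `C₀`"): for every scaling factor `λ` (vacuous unless `λ > 1`) the plain and, for
every `R ∈ O(3)`, the rotated Type I `λ`-DSS Liouville statements hold. **Open** (flag); `def`
only. The first conjunct is the case `R = 1` of the second (`rotatedTypeIDSSLiouville_refl_iff`)
and is kept for readability. [folklore] -/
@[conjecture] def TypeIDSSLiouvilleConjecture : Prop :=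
  ∀ c : ℝ, TypeIDSSLiouville c ∧ ∀ R : ℝ³ ≃ₗᵢ[ℝ] ℝ³, RotatedTypeIDSSLiouville c R

end Summit.NavierStokesRegularity.NavierStokesRegularity
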